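import Literature.NumberTheory.Sieve.RosserSieveTheoremOneHalfLt
import Literature.NumberTheory.Sieve.DiamondHalberstamTwoLinearSetup
import Summits.Parity.GeneralizedHardyLittlewood.Theorems.LeeYangFibresCellParityLawDimension
import HarnessLib

/-!
# Route `LeeYangFibres`, crux `FibreHyperbolicityAlong` (stmt-Parity-18103), line
# `sifted-chowla-distillation`: the SHARP Fundamental Lemma behind `stub_siftedSinglesAlong` (helper file 1)

Two sieve facts, both PROVED here from the tree's Rosser–Iwaniec sieve (`Literature.NumberTheory.Sieve.RosserSieve*`):
* `fundamental_lemma_superexp` — **the Fundamental Lemma with super-exponential decay**: for `κ > 1/2`, a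
  regularity constant `L` and ANY rate `M` there are `s₀`, `C ≥ 0` such that every sifted sequence with
  Iwaniec's condition `Ω(κ, L)` satisfies, for `2 ≤ z ≤ y`, `s = log y/log z ≥ s₀`,
  `|S(𝒜, z; x) − X V(z)| ≤ X V(z) (e^{−Ms} + C (log y)^{−1/3}) + ∑_{d ∣ P(z), d ≤ y} |R_d(x)|`.
  Proof: Iwaniec's Theorem 1 (`Iwaniec1980_thm1_upper/lower_of_half_lt`, PROVED for `κ > 1/2`) and
  `F(s) − 1 = s^{−κ}T⁺(s) ≤ c q⁺(s)`, `1 − f(s) = s^{−κ}T⁻(s) ≤ c q⁻(s)` (`BetaSieve.eqOn_cand_of_greatest`,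
  `BetaSieve.lemma17`) with `q^± ≤ e^{−M's}` eventually for every `M'` (`BetaSieve.majorantHyp_of_greatest`;
  Iwaniec's Lemma 13, `q^± = e^{−s log s(1+o(1))}`): the `e^{−s log s}` Fundamental Lemma of Halberstam–Richert
  Thm 2.5 in the qualitative form "faster than every exponential".
* `exists_hasIwaniecDimension_rootDensity` — **root-count densities with `ω ≤ B` are `Ω(B, Λ_B)`-regular**
  (termwise comparison with `(1 − 1/p)^{−B}`, Mertens' product theorem with rate
  `PairProducts.abs_log_mertensProd_sub_le`; template `hasIwaniecDimension_rootDensity`, dimension `2`).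

References: H. Iwaniec, *Rosser's sieve*, Acta Arith. 36 (1980), Thm 1, Lemma 13 [IwaniecActaArith1980];
H. Halberstam, H.-E. Richert, *Sieve Methods* (1974), Thm 2.5 [HalberstamRichert1974];
G. H. Hardy, E. M. Wright, Thm 429 (Mertens) [HardyWright2008].
-/

noncomputable section

open Finset Filter
open scoped BigOperators

namespace Summit.Parity.GeneralizedHardyLittlewood.Cruxes.FibreHyperbolicityAlong.SiftedChowlaDistillation

open Literature.NumberTheory.Sieve

/-! ## The Fundamental Lemma with super-exponential decay (from Iwaniec's Theorem 1) -/

/-- **Super-exponential decay of the sieve functions**: for the greatest `β`-sieve data `(F, f, β, A)`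
of dimension `κ > 1/2` and every `M` there is `s₀ ≥ 1` with `F(s) − 1 ≤ e^{−Ms}` and `1 − f(s) ≤ e^{−Ms}`
for `s ≥ s₀` (`F − 1 = s^{−κ}T⁺ ≤ c q⁺`, `1 − f = s^{−κ}T⁻ ≤ c q⁻`, `q^± ≤ e^{−(M+c)s}` eventually).
[cite: IwaniecActaArith1980, Lemma 13 with §9 (p. 202)] -/
theorem sieveFun_sub_one_le_exp {κ : ℝ} (hκ : 1 / 2 < κ) {B : (ℝ → ℝ) × (ℝ → ℝ) × ℝ × ℝ}
    (hB : IsGreatestBetaSieveData κ B) (M : ℝ) :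
    ∃ s₀ : ℝ, 1 ≤ s₀ ∧ ∀ s : ℝ, s₀ ≤ s →
      B.1 s - 1 ≤ Real.exp (-(M * s)) ∧ 1 - B.2.1 s ≤ Real.exp (-(M * s)) := by
  have hκ0 : 0 < κ := by linarith
  set β := B.2.2.1 with hβdef
  obtain ⟨-, hF, hf⟩ := BetaSieve.eqOn_cand_of_greatest hκ hB
  obtain ⟨c, hc, h17⟩ := BetaSieve.lemma17 hκ hB
  have hMH := BetaSieve.majorantHyp_of_greatest hκ hB
  have hβ1 : 1 < β := hMH.one_lt
  have hbdP : ∀ (N : ℕ) (u : ℝ), β - 1 ≤ u →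
      BetaSieve.contT 1 κ β N u ≤ c * RosserMajorant.qUpper κ β u :=
    fun N u hu => ((h17 N).2 u hu).le
  have hbdM : ∀ (N : ℕ) (u : ℝ), β ≤ u →
      BetaSieve.contT 0 κ β N u ≤ c * RosserMajorant.qLower κ β u :=
    fun N u hu => ((h17 N).1 u hu).le
  obtain ⟨s₁, hs₁⟩ := Filter.eventually_atTop.mp (hMH.eventually_qUpper_le (M + c))
  obtain ⟨s₂, hs₂⟩ := Filter.eventually_atTop.mp (hMH.eventually_qLower_le (M + c))
  refine ⟨max (max s₁ s₂) (β + 1), le_trans (by linarith) (le_max_right _ _), fun s hs => ?_⟩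
  have hs1 : s₁ ≤ s := le_trans ((le_max_left _ _).trans (le_max_left _ _)) hs
  have hs2 : s₂ ≤ s := le_trans ((le_max_right _ _).trans (le_max_left _ _)) hs
  have hsβ : β + 1 ≤ s := le_trans (le_max_right _ _) hs
  have hsone : 1 ≤ s := by linarith
  have hs0 : 0 < s := by linarith
  -- `s^{-κ} ≤ 1`
  have hpow : s ^ (-κ) ≤ 1 := Real.rpow_le_one_of_one_le_of_nonpos hsone (by linarith)
  have hpow0 : 0 ≤ s ^ (-κ) := Real.rpow_nonneg hs0.le _
  have hqU := (hMH.pos s hs0).1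
  have hqL := (hMH.pos s hs0).2
  -- `c e^{-(M+c)s} ≤ e^{-Ms}`
  have hce : c * Real.exp (-((M + c) * s)) ≤ Real.exp (-(M * s)) := by
    have h1 := BetaSieve.mul_exp_neg_mul_le_one hc.le hsone
    have e : Real.exp (-((M + c) * s)) = Real.exp (-(c * s)) * Real.exp (-(M * s)) := by
      rw [← Real.exp_add]; ring_nf
    rw [e, ← mul_assoc]
    exact mul_le_of_le_one_left (Real.exp_pos _).le h1
  constructor
  · -- `F(s) - 1 = s^{-κ} T⁺(s) ≤ c q⁺(s) ≤ c e^{-(M+c)s}`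
    rw [hF (show s ∈ Set.Ioi (0 : ℝ) from hs0), BetaSieve.candUpper]
    have hT : BetaSieve.contTLim 1 κ β s ≤ c * RosserMajorant.qUpper κ β s :=
      BetaSieve.contTLim_one_le hbdP (by linarith)
    have hcq : 0 ≤ c * RosserMajorant.qUpper κ β s := mul_nonneg hc.le hqU.le
    calc 1 + s ^ (-κ) * BetaSieve.contTLim 1 κ β s - 1 = s ^ (-κ) * BetaSieve.contTLim 1 κ β s := by ring
      _ ≤ s ^ (-κ) * (c * RosserMajorant.qUpper κ β s) := mul_le_mul_of_nonneg_left hT hpow0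
      _ ≤ 1 * (c * RosserMajorant.qUpper κ β s) := mul_le_mul_of_nonneg_right hpow hcq
      _ = c * RosserMajorant.qUpper κ β s := one_mul _
      _ ≤ c * Real.exp (-((M + c) * s)) := mul_le_mul_of_nonneg_left (hs₁ s hs1) hc.le
      _ ≤ Real.exp (-(M * s)) := hce
  · -- `1 - f(s) = s^{-κ} T⁻(s) ≤ c q⁻(s) ≤ c e^{-(M+c)s}`
    rw [hf (show s ∈ Set.Ioi (0 : ℝ) from hs0), BetaSieve.candLower_eq_of_lt (show β < s by linarith)]
    have hT : BetaSieve.contTLim 0 κ β s ≤ c * RosserMajorant.qLower κ β s :=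
      BetaSieve.contTLim_zero_le hbdM (by linarith)
    have hcq : 0 ≤ c * RosserMajorant.qLower κ β s := mul_nonneg hc.le hqL.le
    calc 1 - (1 - s ^ (-κ) * BetaSieve.contTLim 0 κ β s) = s ^ (-κ) * BetaSieve.contTLim 0 κ β s := by ring
      _ ≤ s ^ (-κ) * (c * RosserMajorant.qLower κ β s) := mul_le_mul_of_nonneg_left hT hpow0
      _ ≤ 1 * (c * RosserMajorant.qLower κ β s) := mul_le_mul_of_nonneg_right hpow hcq
      _ = c * RosserMajorant.qLower κ β s := one_mul _
      _ ≤ c * Real.exp (-((M + c) * s)) := mul_le_mul_of_nonneg_left (hs₂ s hs2) hc.le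
      _ ≤ Real.exp (-(M * s)) := hce

/-- Iwaniec's remainder range `d < ⌈y⌉`, `d ∣ P(z)` sits inside the Fundamental-Lemma range
`d ∣ P(z)`, `d ≤ y`. [folklore] -/
theorem sum_range_filter_dvd_le (A : SieveSequence) (x y z : ℝ) :
    ∑ d ∈ (Finset.range ⌈y⌉₊).filter (· ∣ primesProdBelow z), |A.remainder d x| ≤
      ∑ d ∈ (primesProdBelow z).divisors.filter (fun d : ℕ => (d : ℝ) ≤ y), |A.remainder d x| := by
  refine Finset.sum_le_sum_of_subset_of_nonneg (fun d hd => ?_) fun _ _ _ => abs_nonneg _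
  rw [Finset.mem_filter, Finset.mem_range] at hd
  rw [Finset.mem_filter, Nat.mem_divisors]
  exact ⟨⟨hd.2, primesProdBelow_ne_zero z⟩, (Nat.lt_ceil.mp hd.1).le⟩

/-- **The Fundamental Lemma with super-exponential decay** (the `e^{−s log s}` Fundamental Lemma of
Halberstam–Richert Thm 2.5 in qualitative form, here from Iwaniec's Theorem 1): for `κ > 1/2`, `L`
and every `M` there are `s₀` and `C ≥ 0` such that for every sifted sequence `𝒜` with `Ω(κ, L)`
(`HasIwaniecDimension`), all `x`, `2 ≤ z ≤ y` with `s = log y/log z ≥ s₀` and `X(x) ≥ 0`,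
`|S(𝒜, z; x) − X V(z)| ≤ X V(z) (e^{−Ms} + C (log y)^{−1/3}) + ∑_{d ∣ P(z), d ≤ y} |R_d(x)|`.
[cite: IwaniecActaArith1980, Thm 1 (1.4)–(1.6) with Lemma 13] [cite: HalberstamRichert1974, Thm. 2.5] -/
theorem fundamental_lemma_superexp {κ : ℝ} (hκ : 1 / 2 < κ) (L M : ℝ) :
    ∃ s₀ C : ℝ, 0 ≤ C ∧ ∀ A : SieveSequence, HasIwaniecDimension A.density κ L →
      ∀ x y z : ℝ, 2 ≤ z → z ≤ y → 0 ≤ A.size x → s₀ ≤ Real.log y / Real.log z →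
        |A.sifted x (primesProdBelow z) - A.size x * A.densityProduct (primesProdBelow z)| ≤
          A.size x * A.densityProduct (primesProdBelow z) *
              (Real.exp (-(M * (Real.log y / Real.log z))) + C * Real.log y ^ (-(1 / 3 : ℝ))) +
            ∑ d ∈ (primesProdBelow z).divisors.filter (fun d : ℕ => (d : ℝ) ≤ y),
              |A.remainder d x| := by
  obtain ⟨B, hB, hU⟩ := Iwaniec1980_thm1_upper_of_half_lt hκ
  obtain ⟨B', hB', hLo⟩ := Iwaniec1980_thm1_lower_of_half_lt hκ
  obtain ⟨C₁, h1⟩ := hU L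
  obtain ⟨C₂, h2⟩ := hLo L
  obtain ⟨s₀, hs₀1, hdec⟩ := sieveFun_sub_one_le_exp hκ hB M
  have hff : Set.EqOn B.2.1 B'.2.1 (Set.Ioi 0) := (hB.unique hB').2.1
  refine ⟨s₀, max (max C₁ C₂) 0, le_max_right _ _, fun A hA x y z hz hzy hX hs => ?_⟩
  set s := Real.log y / Real.log z with hsdef
  set X := A.size x with hXdef
  set V := A.densityProduct (primesProdBelow z) with hVdef
  set R := ∑ d ∈ (primesProdBelow z).divisors.filter (fun d : ℕ => (d : ℝ) ≤ y),
    |A.remainder d x| with hRdef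
  set C := max (max C₁ C₂) 0 with hCdef
  have hs0 : 0 < s := lt_of_lt_of_le (by linarith) hs
  have hV0 : 0 < V := hA.densityProduct_pos z
  have hXV : 0 ≤ X * V := mul_nonneg hX hV0.le
  have hlogy : 0 ≤ Real.log y := Real.log_nonneg (by linarith)
  have hly : 0 ≤ Real.log y ^ (-(1 / 3 : ℝ)) := Real.rpow_nonneg hlogy _
  have hC1 : C₁ ≤ C := (le_max_left _ _).trans (le_max_left _ _)
  have hC2 : C₂ ≤ C := (le_max_right _ _).trans (le_max_left _ _)
  have hRle := sum_range_filter_dvd_le A x y z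
  obtain ⟨hFd, hfd⟩ := hdec s hs
  -- upper side
  have hup := h1 A hA x y z hz hzy hX
  have hup' : A.sifted x (primesProdBelow z) - X * V ≤
      X * V * (Real.exp (-(M * s)) + C * Real.log y ^ (-(1 / 3 : ℝ))) + R := by
    have e1 : X * V * (B.1 s + C₁ * Real.log y ^ (-(1 / 3 : ℝ))) =
        X * V + X * V * ((B.1 s - 1) + C₁ * Real.log y ^ (-(1 / 3 : ℝ))) := by ring
    have h3 : (B.1 s - 1) + C₁ * Real.log y ^ (-(1 / 3 : ℝ)) ≤
        Real.exp (-(M * s)) + C * Real.log y ^ (-(1 / 3 : ℝ)) :=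
      add_le_add hFd (mul_le_mul_of_nonneg_right hC1 hly)
    have h4 := mul_le_mul_of_nonneg_left h3 hXV
    rw [e1] at hup
    linarith
  -- lower side
  have hlo := h2 A hA x y z hz hzy hX
  have hlo' : X * V - A.sifted x (primesProdBelow z) ≤
      X * V * (Real.exp (-(M * s)) + C * Real.log y ^ (-(1 / 3 : ℝ))) + R := by
    rw [← hff (show s ∈ Set.Ioi (0 : ℝ) from hs0)] at hlo
    have e1 : X * V * (B.2.1 s - C₂ * Real.log y ^ (-(1 / 3 : ℝ))) =
        X * V - X * V * ((1 - B.2.1 s) + C₂ * Real.log y ^ (-(1 / 3 : ℝ))) := by ring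
    have h3 : (1 - B.2.1 s) + C₂ * Real.log y ^ (-(1 / 3 : ℝ)) ≤
        Real.exp (-(M * s)) + C * Real.log y ^ (-(1 / 3 : ℝ)) :=
      add_le_add hfd (mul_le_mul_of_nonneg_right hC2 hly)
    have h4 := mul_le_mul_of_nonneg_left h3 hXV
    rw [e1] at hlo
    linarith
  exact abs_sub_le_iff.mpr ⟨hup', hlo'⟩


/-! ## Iwaniec's dimension condition `Ω(B, Λ_B)` for root-count densities with `ω ≤ B` -/

/-- Elementary: for `0 ≤ x ≤ 1/2`, `(1 − x)⁻¹ ≤ (1 + x)(1 + 2x²)`. [folklore] -/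
theorem inv_one_sub_le_mul {x : ℝ} (hx0 : 0 ≤ x) (hx : x ≤ 1 / 2) :
    (1 - x)⁻¹ ≤ (1 + x) * (1 + 2 * x ^ 2) := by
  rw [inv_le_iff_one_le_mul₀ (by linarith)]
  have h : 0 ≤ x ^ 2 * (1 - 2 * x ^ 2) := mul_nonneg (sq_nonneg x) (by nlinarith)
  have e : (1 + x) * (1 + 2 * x ^ 2) * (1 - x) = 1 + x ^ 2 * (1 - 2 * x ^ 2) := by ring
  rw [e]
  linarith

/-- Elementary: `1 + B/p ≤ ((1 − 1/p)⁻¹)^B` for `p ≥ 2` (Bernoulli and `1 + 1/p ≤ (1 − 1/p)⁻¹`).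
[folklore] -/
theorem one_add_div_le_mertensFactor_pow (B : ℕ) {p : ℝ} (hp : 2 ≤ p) :
    1 + (B : ℝ) / p ≤ ((1 - p⁻¹)⁻¹) ^ B := by
  have hp0 : 0 < p := by linarith
  have h1 : 1 + (B : ℝ) / p ≤ (1 + p⁻¹) ^ B := by
    have h := one_add_mul_le_pow (a := p⁻¹) (by have := inv_nonneg.mpr hp0.le; linarith) B
    rw [div_eq_mul_inv]; exact h
  have h2 : 1 + p⁻¹ ≤ (1 - p⁻¹)⁻¹ := by
    have hi0 : 0 ≤ p⁻¹ := inv_nonneg.mpr hp0.le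
    have hih : p⁻¹ ≤ 1 / 2 := by
      rw [inv_eq_one_div]; exact div_le_div_of_nonneg_left zero_le_one two_pos hp
    have hsub : 0 < 1 - p⁻¹ := by linarith
    have key : (1 + p⁻¹) * (1 - p⁻¹) ≤ 1 := by nlinarith [sq_nonneg p⁻¹]
    calc 1 + p⁻¹ = (1 + p⁻¹) * (1 - p⁻¹) / (1 - p⁻¹) := (mul_div_cancel_right₀ _ hsub.ne').symm
      _ ≤ 1 / (1 - p⁻¹) := div_le_div_of_nonneg_right key hsub.le
      _ = (1 - p⁻¹)⁻¹ := one_div _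
  exact h1.trans (pow_le_pow_left₀ (by positivity) h2 B)

/-- **Termwise comparison with the Mertens factor.**  If `ω_F(p) ≤ B` and `ω_F(p) < p` for every
prime, then for every prime `p`
`(1 − ω_F(p)/p)⁻¹ ≤ c_p · ((1 − 1/p)⁻¹)^B · e^{2B²/p²}` with `c_p = 2B` for `p ≤ 2B` (where the left
side is `≤ p`) and `c_p = 1` for `p > 2B` (`(1 − B/p)⁻¹ ≤ (1 + B/p)(1 + 2B²/p²)`). [folklore] -/
theorem inv_one_sub_rootDensity_le_of_le {F : Polynomial ℤ} {B : ℕ}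
    (hle : ∀ p : ℕ, p.Prime → polyRootCountMod ![F] p ≤ B)
    (hlt : ∀ p : ℕ, p.Prime → polyRootCountMod ![F] p < p) {p : ℕ} (hp : p.Prime) :
    (1 - rootDensity F p)⁻¹ ≤
      (if p ≤ 2 * B then (2 * B : ℝ) else 1) * ((1 - (p : ℝ)⁻¹)⁻¹) ^ B *
        Real.exp (2 * (B : ℝ) ^ 2 * (1 / (p : ℝ) ^ 2)) := by
  have hp2 : (2 : ℝ) ≤ p := by exact_mod_cast hp.two_le
  have hp0 : (0 : ℝ) < p := by linarith
  have hM1 : 1 ≤ ((1 - (p : ℝ)⁻¹)⁻¹) ^ B := by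
    refine one_le_pow₀ ?_
    rw [one_le_inv_iff₀]
    have : (0 : ℝ) < (p : ℝ)⁻¹ := inv_pos.mpr hp0
    have : (p : ℝ)⁻¹ ≤ 1 / 2 := by rw [inv_eq_one_div]; exact div_le_div_of_nonneg_left zero_le_one two_pos hp2
    exact ⟨by linarith, by linarith⟩
  have hE1 : 1 ≤ Real.exp (2 * (B : ℝ) ^ 2 * (1 / (p : ℝ) ^ 2)) := Real.one_le_exp (by positivity)
  have hρB : (polyRootCountMod ![F] p : ℝ) ≤ B := by exact_mod_cast hle p hp
  have hρp : (polyRootCountMod ![F] p : ℝ) + 1 ≤ p := by exact_mod_cast Nat.succ_le_of_lt (hlt p hp)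
  rw [rootDensity_apply]
  by_cases hpB : p ≤ 2 * B
  · rw [if_pos hpB]
    have h1 : 1 - (polyRootCountMod ![F] p : ℝ) / p = ((p : ℝ) - polyRootCountMod ![F] p) / p := by
      field_simp
    have hden : (1 : ℝ) ≤ (p : ℝ) - polyRootCountMod ![F] p := by linarith
    calc (1 - (polyRootCountMod ![F] p : ℝ) / p)⁻¹ = p / ((p : ℝ) - polyRootCountMod ![F] p) := by
          rw [h1, inv_div]
      _ ≤ p := div_le_self hp0.le hden
      _ ≤ 2 * B := by exact_mod_cast hpB
      _ = (2 * B : ℝ) * 1 * 1 := by ring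
      _ ≤ (2 * B : ℝ) * ((1 - (p : ℝ)⁻¹)⁻¹) ^ B * Real.exp (2 * (B : ℝ) ^ 2 * (1 / (p : ℝ) ^ 2)) := by
          gcongr
  · rw [if_neg hpB, one_mul]
    push Not at hpB
    have hpB' : 2 * (B : ℝ) < p := by exact_mod_cast hpB
    set x : ℝ := (B : ℝ) / p with hx
    have hx0 : 0 ≤ x := by positivity
    have hxh : x ≤ 1 / 2 := by rw [hx, div_le_iff₀ hp0]; linarith
    have hxρ : (polyRootCountMod ![F] p : ℝ) / p ≤ x := div_le_div_of_nonneg_right hρB hp0.le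
    calc (1 - (polyRootCountMod ![F] p : ℝ) / p)⁻¹ ≤ (1 - x)⁻¹ := by
          apply inv_anti₀ (by linarith); linarith
      _ ≤ (1 + x) * (1 + 2 * x ^ 2) := inv_one_sub_le_mul hx0 hxh
      _ ≤ ((1 - (p : ℝ)⁻¹)⁻¹) ^ B * Real.exp (2 * (B : ℝ) ^ 2 * (1 / (p : ℝ) ^ 2)) := by
          refine mul_le_mul (one_add_div_le_mertensFactor_pow B hp2) ?_ (by positivity)
            (zero_le_one.trans hM1)
          have e : 2 * x ^ 2 = 2 * (B : ℝ) ^ 2 * (1 / (p : ℝ) ^ 2) := by rw [hx]; field_simp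
          rw [e]
          linarith [Real.add_one_le_exp (2 * (B : ℝ) ^ 2 * (1 / (p : ℝ) ^ 2))]

/-- **Root-count densities with `ω ≤ B` satisfy Iwaniec's `Ω(B, Λ_B)`.**  If `ω_F(p) ≤ B` and
`ω_F(p) < p` for every prime `p` (`B ≥ 1`), then `0 ≤ ω_F(p)/p < 1` and for `2 ≤ w ≤ z`,
`∏_{w ≤ p < z} (1 − ω_F(p)/p)⁻¹ ≤ (log z/log w)^B (1 + Λ_B/log w)`, `Λ_B = a e^{a/log 2}`,
`a = (2B+1)(log 2B)² + 50B + 4B²` (uniform in `F`):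
termwise `inv_one_sub_rootDensity_le_of_le`, `∏ c_p ≤ (2B)^{2B+1} ≤ e^{(2B+1)(log 2B)²/log w}` (only when
`w ≤ 2B`), `(Π(z)/Π(w))^B ≤ (log z/log w)^B e^{50B/log w}`, `2B² ∑_{w ≤ p} p⁻² ≤ 4B²/log w`. [cite: HardyWright2008, Thm 429 (§22.8)] -/
theorem exists_hasIwaniecDimension_rootDensity {B : ℕ} (hB : 1 ≤ B) :
    ∃ Lreg : ℝ, ∀ F : Polynomial ℤ, (∀ p : ℕ, p.Prime → polyRootCountMod ![F] p ≤ B) →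
      (∀ p : ℕ, p.Prime → polyRootCountMod ![F] p < p) → HasIwaniecDimension (rootDensity F) B Lreg := by
  set a₁ : ℝ := ((2 * B + 1 : ℕ) : ℝ) * Real.log (2 * B) ^ 2 with ha₁
  set a : ℝ := a₁ + 50 * B + 4 * (B : ℝ) ^ 2 with ha
  refine ⟨a * Real.exp (a / Real.log 2), fun F hle hlt => ?_⟩
  have hg : ∀ p : ℕ, p.Prime → 0 ≤ rootDensity F p ∧ rootDensity F p < 1 := by
    intro p hp
    refine ⟨rootDensity_nonneg F p, ?_⟩
    rw [rootDensity_apply, div_lt_one (by exact_mod_cast hp.pos)]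
    exact_mod_cast hlt p hp
  refine ⟨hg, fun w z hw hwz => ?_⟩
  set S := (Nat.primesBelow ⌈z⌉₊).filter (fun p : ℕ => w ≤ (p : ℝ)) with hS
  have hB1 : (1 : ℝ) ≤ B := by exact_mod_cast hB
  have h2B : (2 : ℝ) ≤ 2 * B := by linarith
  have hlog2B : 0 < Real.log (2 * B) := Real.log_pos (by linarith)
  have ha₁0 : 0 ≤ a₁ := by positivity
  have ha0 : 0 ≤ a := by positivity
  have hlogw : 0 < Real.log w := Real.log_pos (by linarith)
  have hlogz : 0 < Real.log z := Real.log_pos (by linarith)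
  have hw0 : (0 : ℝ) < w := by linarith
  have hprime : ∀ p ∈ S, p.Prime := fun p hp => Nat.prime_of_mem_primesBelow (Finset.mem_filter.mp hp).1
  have hwp : ∀ p ∈ S, w ≤ (p : ℝ) := fun p hp => (Finset.mem_filter.mp hp).2
  -- termwise
  have hnonneg : ∀ p ∈ S, 0 ≤ (1 - rootDensity F p)⁻¹ := fun p hp =>
    inv_nonneg.mpr (sub_nonneg.mpr (hg p (hprime p hp)).2.le)
  have hpt : ∀ p ∈ S, (1 - rootDensity F p)⁻¹ ≤
      (if p ≤ 2 * B then (2 * B : ℝ) else 1) * ((1 - (p : ℝ)⁻¹)⁻¹) ^ B *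
        Real.exp (2 * (B : ℝ) ^ 2 * (1 / (p : ℝ) ^ 2)) :=
    fun p hp => inv_one_sub_rootDensity_le_of_le hle hlt (hprime p hp)
  have hprod : ∏ p ∈ S, (1 - rootDensity F p)⁻¹ ≤
      (∏ p ∈ S, (if p ≤ 2 * B then (2 * B : ℝ) else 1)) *
        (PairProducts.mertensProd z / PairProducts.mertensProd w) ^ B *
          Real.exp (2 * (B : ℝ) ^ 2 * ∑ p ∈ S, 1 / (p : ℝ) ^ 2) := by
    calc ∏ p ∈ S, (1 - rootDensity F p)⁻¹
        ≤ ∏ p ∈ S, ((if p ≤ 2 * B then (2 * B : ℝ) else 1) * ((1 - (p : ℝ)⁻¹)⁻¹) ^ B *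
            Real.exp (2 * (B : ℝ) ^ 2 * (1 / (p : ℝ) ^ 2))) := Finset.prod_le_prod hnonneg hpt
      _ = (∏ p ∈ S, (if p ≤ 2 * B then (2 * B : ℝ) else 1)) * (∏ p ∈ S, (1 - (p : ℝ)⁻¹)⁻¹) ^ B *
            Real.exp (2 * (B : ℝ) ^ 2 * ∑ p ∈ S, 1 / (p : ℝ) ^ 2) := by
          rw [Finset.prod_mul_distrib, Finset.prod_mul_distrib, Finset.prod_pow, ← Real.exp_sum,
            Finset.mul_sum]
      _ = _ := by rw [hS, PairProducts.prod_filter_eq_mertensProd_div hwz]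
  -- the small primes: `∏ c_p ≤ e^{a₁/log w}`
  have hsmall : ∏ p ∈ S, (if p ≤ 2 * B then (2 * B : ℝ) else 1) ≤ Real.exp (a₁ / Real.log w) := by
    by_cases hwB : w ≤ 2 * B
    · have hcard : #(S.filter (fun p : ℕ => p ≤ 2 * B)) ≤ 2 * B + 1 :=
        (Finset.card_le_card fun p hp => Finset.mem_Iic.mpr (Finset.mem_filter.mp hp).2).trans
          (Nat.card_Iic _).le
      have h1 : ∏ p ∈ S, (if p ≤ 2 * B then (2 * B : ℝ) else 1) ≤ (2 * B : ℝ) ^ (2 * B + 1) := by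
        rw [← Finset.prod_filter, Finset.prod_const]
        exact pow_le_pow_right₀ (by linarith) hcard
      have h2 : (2 * B : ℝ) ^ (2 * B + 1) = Real.exp (((2 * B + 1 : ℕ) : ℝ) * Real.log (2 * B)) := by
        rw [← Real.rpow_natCast, Real.rpow_def_of_pos (by linarith)]
        ring_nf
      have h3 : ((2 * B + 1 : ℕ) : ℝ) * Real.log (2 * B) ≤ a₁ / Real.log w := by
        rw [ha₁, le_div_iff₀ hlogw]
        have hlw : Real.log w ≤ Real.log (2 * B) := Real.log_le_log hw0 hwB
        have h0 : 0 ≤ ((2 * B + 1 : ℕ) : ℝ) * Real.log (2 * B) := by positivity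
        calc ((2 * B + 1 : ℕ) : ℝ) * Real.log (2 * B) * Real.log w
            ≤ ((2 * B + 1 : ℕ) : ℝ) * Real.log (2 * B) * Real.log (2 * B) :=
              mul_le_mul_of_nonneg_left hlw h0
          _ = ((2 * B + 1 : ℕ) : ℝ) * Real.log (2 * B) ^ 2 := by ring
      rw [h2] at h1
      exact h1.trans (Real.exp_le_exp.mpr h3)
    · push Not at hwB
      have h1 : ∏ p ∈ S, (if p ≤ 2 * B then (2 * B : ℝ) else 1) = 1 := by
        refine Finset.prod_eq_one fun p hp => ?_
        have h' : (2 * B : ℝ) < p := lt_of_lt_of_le hwB (hwp p hp)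
        rw [if_neg (by exact_mod_cast not_le.mpr h')]
      rw [h1]; exact Real.one_le_exp (by positivity)
  -- Mertens with rate: `(Π(z)/Π(w))^B ≤ (log z/log w)^B e^{50B/log w}`
  set R := PairProducts.mertensProd z / PairProducts.mertensProd w with hR
  have hRpos : 0 < R := div_pos (PairProducts.mertensProd_pos z) (PairProducts.mertensProd_pos w)
  obtain ⟨-, hz2⟩ := abs_le.mp (PairProducts.abs_log_mertensProd_sub_le (le_trans hw hwz))
  obtain ⟨hw1, -⟩ := abs_le.mp (PairProducts.abs_log_mertensProd_sub_le hw)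
  have hlogR : Real.log R ≤ Real.log (Real.log z) - Real.log (Real.log w) + 50 / Real.log w := by
    rw [hR, Real.log_div (PairProducts.mertensProd_pos z).ne' (PairProducts.mertensProd_pos w).ne']
    have : 25 / Real.log z ≤ 25 / Real.log w :=
      div_le_div_of_nonneg_left (by norm_num) hlogw (Real.log_le_log (by linarith) hwz)
    have e50 : (50 : ℝ) / Real.log w = 2 * (25 / Real.log w) := by ring
    linarith
  have hRB : R ^ B ≤ (Real.log z / Real.log w) ^ (B : ℝ) * Real.exp (50 * B / Real.log w) := by
    have e1 : R ^ B = Real.exp (B * Real.log R) := by rw [← Real.rpow_natCast, Real.rpow_def_of_pos hRpos, mul_comm]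
    have e2 : (Real.log z / Real.log w) ^ (B : ℝ) * Real.exp (50 * B / Real.log w) =
        Real.exp (B * (Real.log (Real.log z) - Real.log (Real.log w)) + 50 * B / Real.log w) := by
      rw [Real.rpow_def_of_pos (div_pos hlogz hlogw), Real.log_div hlogz.ne' hlogw.ne',
        ← Real.exp_add]
      congr 1
      ring
    rw [e1, e2, Real.exp_le_exp]
    have hB0 : (0 : ℝ) ≤ B := by linarith
    have := mul_le_mul_of_nonneg_left hlogR hB0
    have e3 : (B : ℝ) * (Real.log (Real.log z) - Real.log (Real.log w) + 50 / Real.log w) =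
        B * (Real.log (Real.log z) - Real.log (Real.log w)) + 50 * B / Real.log w := by ring
    linarith
  -- the `1/p²` tail
  have htail : 2 * (B : ℝ) ^ 2 * ∑ p ∈ S, 1 / (p : ℝ) ^ 2 ≤ 4 * (B : ℝ) ^ 2 / Real.log w := by
    have h1 := sum_window_inv_sq_le (z := z) hw
    rw [← hS] at h1
    have hlw : Real.log w ≤ w := by linarith [Real.log_le_sub_one_of_pos hw0]
    calc 2 * (B : ℝ) ^ 2 * ∑ p ∈ S, 1 / (p : ℝ) ^ 2 ≤ 2 * (B : ℝ) ^ 2 * (2 / w) := by gcongr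
      _ = 4 * (B : ℝ) ^ 2 / w := by ring
      _ ≤ 4 * (B : ℝ) ^ 2 / Real.log w := div_le_div_of_nonneg_left (by positivity) hlogw hlw
  -- assemble
  have hrpow0 : 0 ≤ (Real.log z / Real.log w) ^ (B : ℝ) := Real.rpow_nonneg (div_pos hlogz hlogw).le _
  calc ∏ p ∈ S, (1 - rootDensity F p)⁻¹
      ≤ (∏ p ∈ S, (if p ≤ 2 * B then (2 * B : ℝ) else 1)) * R ^ B *
          Real.exp (2 * (B : ℝ) ^ 2 * ∑ p ∈ S, 1 / (p : ℝ) ^ 2) := hprod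
    _ ≤ Real.exp (a₁ / Real.log w) * ((Real.log z / Real.log w) ^ (B : ℝ) * Real.exp (50 * B / Real.log w)) *
          Real.exp (4 * (B : ℝ) ^ 2 / Real.log w) := by
        gcongr
    _ = (Real.log z / Real.log w) ^ (B : ℝ) * Real.exp (a / Real.log w) := by
        have e : a / Real.log w = a₁ / Real.log w + 50 * B / Real.log w + 4 * (B : ℝ) ^ 2 / Real.log w := by
          rw [ha]; ring
        rw [e, Real.exp_add, Real.exp_add]; ring
    _ ≤ (Real.log z / Real.log w) ^ (B : ℝ) * (1 + a * Real.exp (a / Real.log 2) / Real.log w) :=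
        mul_le_mul_of_nonneg_left (CellParityLaw.SectionAnnihilator.DimensionAux.exp_div_log_le ha0 hw) hrpow0

/-! ## Registered-stub form (for `--supports stmt-Parity-18103`) -/

/-- **Stub form of `fundamental_lemma_superexp`** (sub-goal of the line `sifted-chowla-distillation`, to be
registered as `stub_sharpFundamentalLemma`; the header below is the registered one-line signature verbatim,
fully qualified). [cite: IwaniecActaArith1980, Thm 1 (1.4)–(1.6) with Lemma 13] -/
theorem stub_sharpFundamentalLemma : ∀ (κ L M : ℝ), 1 / 2 < κ → ∃ s₀ C : ℝ, 0 ≤ C ∧ ∀ A : Literature.NumberTheory.Sieve.SieveSequence, Literature.NumberTheory.Sieve.HasIwaniecDimension A.density κ L → ∀ x y z : ℝ, 2 ≤ z → z ≤ y → 0 ≤ A.size x → s₀ ≤ Real.log y / Real.log z → |A.sifted x (Literature.NumberTheory.Sieve.primesProdBelow z) - A.size x * A.densityProduct (Literature.NumberTheory.Sieve.primesProdBelow z)| ≤ A.size x * A.densityProduct (Literature.NumberTheory.Sieve.primesProdBelow z) * (Real.exp (-(M * (Real.log y / Real.log z))) + C * Real.log y ^ (-(1 / 3 : ℝ))) + ∑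 d ∈ (Literature.NumberTheory.Sieve.primesProdBelow z).divisors.filter (fun d : ℕ => (d : ℝ) ≤ y), |A.remainder d x| :=
  fun _ L M hκ => fundamental_lemma_superexp hκ L M

end Summit.Parity.GeneralizedHardyLittlewood.Cruxes.FibreHyperbolicityAlong.SiftedChowlaDistillation

end
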